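import Mathlib
import Summits.KontsevichZagierPeriods.KontsevichZagierPeriods.Theorems.SoloInformedParamScaledConst
import Summits.KontsevichZagierPeriods.KontsevichZagierPeriods.Theorems.SoloInformedRealParamKernelI
import HarnessLib

/-!
# Solo-informed: propagation of scaled `KZ_ℝ`-relations along a `ℚ`-semialgebraic set of scalars

File B1 of the semi-generic THEOREM T⊗ route (programme note F-s224′; file A is
`SoloInformedParamScaledConst`).  Fix finitely many `ℚ`-representations `Rⱼ`, integer
coefficients `εⱼ`, and for each `j` a coordinate `slot j` of a real scalar vector
`s : Fin M → ℝ`; the **scaled sum** is the formal combination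
`x(s) = ∑ⱼ εⱼ • [(s (slot j)) • (Rⱼ ⊗ ℝ)] ∈ FormalRep ℝ` (`soloInformedScaledSum`; integrand
scaling `soloInformedRealScaleRep`).

**Propagation theorem** (`soloInformed_scaledSum_propagation_prep`, conditional on the Lion–Rolin
preparation fact only): if `x(s₀) ∈ KZOver.relations ℝ` for ONE scalar vector `s₀`, then there is a
`ℚ`-SEMIALGEBRAIC set `T ∋ s₀` of scalar vectors with `x(s) ∈ KZOver.relations ℝ` for EVERY `s ∈ T`.

Proof.  By the definability of `KZ_ℝ`-relations (`soloInformed_definableRelI_of_mem_relations_prep`)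
`x(s₀) = P.comboI p₀` for a parametrised combination `P` whose good parameters form a
`ℚ`-semialgebraic set `V ∋ p₀`.  On the joint parameter space `K ⊕ Fin M` (certificate parameters
and scalars) the clause set "`p ∈ V`; terms with equal keys at `p₀` coincide; a term whose key at
`p₀` is the target `[(s₀ (slot j)) • (Rⱼ ⊗ ℝ)]` coincides with the scaled constant term
`scaledConst (inr (slot j)) Rⱼ`; targets with equal keys at `s₀` have coinciding scaled constant
terms" is `ℚ`-semialgebraic and holds at `(p₀, s₀)`; its projection to the scalars is the set `T`
(Tarski–Seidenberg, `IsSemialgebraic.image_comp_of_finite`).  At a parameter `(p, s)` satisfying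
the clauses, the class-function principle with SEVERAL target keys
(`SoloInformedPCombo.sum_eq_sum_of_comboI_eq`) in `FormalRep ℝ ⧸ relations ℝ` gives
`⟦x(s)⟧ = ⟦P.comboI p⟧ = 0`.  No transcendence is used here: genericity of the scalars enters
only in file B2 (`SoloInformedRealTensorSemiGeneric`), where `T` through an algebraically
independent point is a neighbourhood of it.

References: [cite: KontsevichZagier2001, §1.2]; [cite: BochnakCosteRoy1998, Thm. 2.2.1, Prop. 2.2.4];
[cite: ComteLionRolin2000, Thm. 3].
-/

noncomputable section

open Set MeasureTheory Literature.ModelTheory.ExponentialFields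
  Literature.NumberTheory.Transcendental

namespace Summit.KontsevichZagierPeriods.KontsevichZagierPeriods.Theorems

/-! ### The class-function principle with several target keys -/

namespace SoloInformedPCombo

variable {K : Type} (P : SoloInformedPCombo K)

/-- **Class-function principle, several targets.** If `P.comboI p₀ = ∑ⱼ εⱼ • [κⱼ]` in the free
group, `u` is a function of the key of a term at `p₀`, `u` agrees with `v` whenever a term's key is
a target key `κⱼ`, and `v` is a function of the target key, then
`∑ₜ coefₜ • u t = ∑ⱼ εⱼ • v j` (both are `lift w (P.comboI p₀)` for one function `w` on keys).
[cite: KontsevichZagier2001, §1.2] -/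
theorem sum_eq_sum_of_comboI_eq {β : Type*} [AddCommGroup β] {J : Type*} [Fintype J]
    (κ : J → Σ n, KZOver.IntegralRep ℝ n) (ε : J → ℤ) {p₀ : K → ℝ}
    (hc : P.comboI p₀ = ∑ j, ε j • FreeAbelianGroup.of (κ j)) (u : P.ι → β) (v : J → β)
    (hu : ∀ t t', P.keyI p₀ t = P.keyI p₀ t' → u t = u t')
    (huv : ∀ t j, P.keyI p₀ t = κ j → u t = v j) (hv : ∀ j j', κ j = κ j' → v j = v j') :
    ∑ t, P.coef t • u t = ∑ j, ε j • v j := by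
  classical
  let w : (Σ n, KZOver.IntegralRep ℝ n) → β := fun x =>
    if h : ∃ t, P.keyI p₀ t = x then u h.choose else if h' : ∃ j, κ j = x then v h'.choose else 0
  have hw : ∀ t, w (P.keyI p₀ t) = u t := by
    intro t
    simp only [w]
    split_ifs with h₁ h₂
    · exact hu _ _ h₁.choose_spec
    · exact absurd ⟨t, rfl⟩ h₁
    · exact absurd ⟨t, rfl⟩ h₁
  have hwκ : ∀ j, w (κ j) = v j := by
    intro j
    simp only [w]
    split_ifs with h₁ h₂
    · exact huv _ _ h₁.choose_spec
    · exact hv _ _ h₂.choose_spec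
    · exact absurd ⟨j, rfl⟩ h₂
  have h1 : FreeAbelianGroup.lift w (P.comboI p₀) = ∑ t, P.coef t • u t := by
    rw [lift_comboI]
    simp only [hw]
  have h2 : FreeAbelianGroup.lift w (P.comboI p₀) = ∑ j, ε j • v j := by
    rw [hc, map_sum]
    simp only [map_zsmul, FreeAbelianGroup.lift_apply_of, hwκ]
  exact h1.symm.trans h2

end SoloInformedPCombo

/-! ### Coincidence across an equality of dimensions; coinciding scaled constant terms -/

namespace SoloInformedPTerm

variable {K : Type}

/-- Coinciding I-admissible terms, the first transported along `d = d'`, denote `KZ_ℝ`-congruent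
representations. [cite: KontsevichZagier2001, §1.2] -/
theorem of_repI_sub_mem_of_coin_castDim {d d' : ℕ} (h : d = d') {T : SoloInformedPTerm K d}
    {T' : SoloInformedPTerm K d'} {p : K → ℝ} (hc : (castDim h T).SoloInformedCoin T' p)
    (hT : T.SoloInformedAdmI p) (hT' : T'.SoloInformedAdmI p) :
    KZOver.of (T.repI p) - KZOver.of (T'.repI p) ∈ KZOver.relations ℝ := by
  subst h
  exact of_repI_sub_mem_of_coin hc hT hT'

/-- **Two scaled constant terms with the same domain and equal scaled integrands on it coincide.**
[cite: BochnakCosteRoy1998, Prop. 2.2.4] -/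
theorem coin_scaledConst_scaledConst {n : ℕ} {kc kc' : K} {r r' : KZOver.IntegralRep ℚ n}
    {q : K → ℝ} (hd : r.domain = r'.domain)
    (hi : ∀ x ∈ r.domain, q kc * r.integrand x = q kc' * r'.integrand x) :
    (scaledConst kc r).SoloInformedCoin (scaledConst kc' r') q := by
  refine ⟨fun x => ?_, fun z hz hzG => ?_⟩
  · rw [fibre_scaledConst, fibre_scaledConst, hd]
  · rw [fibre_scaledConst] at hz
    rw [mem_gfibre_scaledConst] at hzG ⊢
    refine ⟨?_, ?_⟩
    · rw [← hd]
      exact hzG.1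
    · rw [hzG.2]
      exact hi _ hz

/-- **Equal scaled targets have coinciding scaled constant terms**: if
`castRep h ((q kc) • (r ⊗ ℝ)) = (q kc') • (r' ⊗ ℝ)`, then `scaledConst kc r` (transported along
`h : n = n'`) coincides with `scaledConst kc' r'` at `q`. [cite: BochnakCosteRoy1998, Prop. 2.2.4] -/
theorem coin_castDim_scaledConst_of_eq {n n' : ℕ} (h : n = n') {kc kc' : K}
    {r : KZOver.IntegralRep ℚ n} {r' : KZOver.IntegralRep ℚ n'} {q : K → ℝ}
    (heq : castRep h (soloInformedRealScaleRep (q kc) (r.baseChange ℝ)) =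
      soloInformedRealScaleRep (q kc') (r'.baseChange ℝ)) :
    (castDim h (scaledConst kc r)).SoloInformedCoin (scaledConst kc' r') q := by
  subst h
  have heq' : soloInformedRealScaleRep (q kc) (r.baseChange ℝ) =
      soloInformedRealScaleRep (q kc') (r'.baseChange ℝ) := heq
  have hd : r.domain = r'.domain := by
    have h₁ := congrArg KZOver.IntegralRep.domain heq'
    simp only [soloInformed_realScaleRep_domain, KZOver.IntegralRep.domain_baseChange] at h₁
    exact h₁
  have hi : ∀ x, q kc * r.integrand x = q kc' * r'.integrand x := fun x => by
    have h₁ := congrFun (congrArg KZOver.IntegralRep.integrand heq') x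
    simp only [soloInformed_realScaleRep_integrand, KZOver.IntegralRep.integrand_baseChange] at h₁
    exact h₁
  exact coin_scaledConst_scaledConst hd fun x _ => hi x

end SoloInformedPTerm

/-! ### Scaled sums -/

/-- **Scaled sum** `x(s) = ∑ⱼ εⱼ • [(s (slot j)) • (Rⱼ ⊗ ℝ)]`: a formal `ℤ`-combination of
integrand scalings of base changes of the `ℚ`-representations `Rⱼ`, the scalar of the `j`-th
generator being the coordinate `slot j` of the real scalar vector `s : Fin M → ℝ`. -/
def soloInformedScaledSum {M : ℕ} {J : Type*} [Fintype J] (R : J → Σ n, KZOver.IntegralRep ℚ n)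
    (slot : J → Fin M) (ε : J → ℤ) (s : Fin M → ℝ) : KZOver.FormalRep ℝ :=
  ∑ j, ε j • KZOver.of (soloInformedRealScaleRep (s (slot j)) ((R j).2.baseChange ℝ))

/-- Unfolding the scaled sum. [cite: KontsevichZagier2001, §1.2] -/
theorem soloInformed_scaledSum_def {M : ℕ} {J : Type*} [Fintype J]
    (R : J → Σ n, KZOver.IntegralRep ℚ n) (slot : J → Fin M) (ε : J → ℤ) (s : Fin M → ℝ) :
    soloInformedScaledSum R slot ε s =
      ∑ j, ε j • KZOver.of (soloInformedRealScaleRep (s (slot j)) ((R j).2.baseChange ℝ)) :=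
  rfl

/-! ### The propagation theorem -/

/-- **Propagation of scaled `KZ_ℝ`-relations along a `ℚ`-semialgebraic set of scalars**
(conditional on the preparation fact).  If the scaled sum `x(s₀)` is a `KZ_ℝ`-relation, then
`x(s)` is a `KZ_ℝ`-relation for every `s` in some `ℚ`-semialgebraic set of scalar vectors
containing `s₀`. [cite: KontsevichZagier2001, §1.2] -/
theorem soloInformed_scaledSum_propagation_prep (hprep : semialgebraicPreparation) {M : ℕ}
    {J : Type*} [Fintype J] (R : J → Σ n, KZOver.IntegralRep ℚ n) (slot : J → Fin M) (ε : J → ℤ)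
    {s₀ : Fin M → ℝ} (h : soloInformedScaledSum R slot ε s₀ ∈ KZOver.relations ℝ) :
    ∃ T : Set (Fin M → ℝ), IsSemialgebraic ℚ T ∧ s₀ ∈ T ∧
      ∀ s ∈ T, soloInformedScaledSum R slot ε s ∈ KZOver.relations ℝ := by
  classical
  obtain ⟨K, hK, P, p₀, V, hV, hp₀, hcombo, hgood, -⟩ :=
    soloInformed_definableRelI_of_mem_relations_prep hprep h
  haveI : Fintype K := hK
  -- joint parameter space `K ⊕ Fin M`: certificate parameters and scalars
  let P' : SoloInformedPCombo (K ⊕ Fin M) := P.pullback Sum.inl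
  let p₀' : K ⊕ Fin M → ℝ := Sum.elim p₀ s₀
  let C : (j : J) → SoloInformedPTerm (K ⊕ Fin M) (R j).1 := fun j =>
    SoloInformedPTerm.scaledConst (Sum.inr (slot j)) (R j).2
  let κ : J → Σ n, KZOver.IntegralRep ℝ n := fun j =>
    ⟨(R j).1, soloInformedRealScaleRep (s₀ (slot j)) ((R j).2.baseChange ℝ)⟩
  have hCadm : ∀ j (p : K ⊕ Fin M → ℝ), (C j).SoloInformedAdmI p := fun j p =>
    SoloInformedPTerm.admI_scaledConst _ _ p
  have hP'adm : ∀ p : K ⊕ Fin M → ℝ, p ∘ Sum.inl ∈ V → P'.SoloInformedAdmI p := fun p hp =>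
    (P.admI_pullback_iff Sum.inl p).2 (hgood _ hp).1
  have hP'rel : ∀ p : K ⊕ Fin M → ℝ, p ∘ Sum.inl ∈ V → P'.comboI p ∈ KZOver.relations ℝ :=
    fun p hp => by
      show (P.pullback Sum.inl).comboI p ∈ _
      rw [SoloInformedPCombo.comboI_pullback]
      exact (hgood _ hp).2
  have hp₀' : p₀' ∘ Sum.inl = p₀ := Sum.elim_comp_inl p₀ s₀
  have hcombo' : P'.comboI p₀' = ∑ j, ε j • FreeAbelianGroup.of (κ j) := by
    show (P.pullback Sum.inl).comboI p₀' = _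
    rw [SoloInformedPCombo.comboI_pullback, hp₀', hcombo]
    rfl
  let Valid : (K ⊕ Fin M → ℝ) → Prop := fun p => p ∘ Sum.inl ∈ V ∧
    (∀ t t' (h : P'.dim t = P'.dim t'), P'.keyI p₀' t = P'.keyI p₀' t' →
      ((P'.term t).castDim h).SoloInformedCoin (P'.term t') p) ∧
    (∀ t j (h : P'.dim t = (R j).1), P'.keyI p₀' t = κ j →
      ((P'.term t).castDim h).SoloInformedCoin (C j) p) ∧
    (∀ j j' (h : (R j).1 = (R j').1), κ j = κ j' →
      ((C j).castDim h).SoloInformedCoin (C j') p)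
  -- (1) the clause set is `ℚ`-semialgebraic
  have hValid : IsSemialgebraic ℚ {p | Valid p} := by
    refine soloInformed_isSemialgebraic_setOf_and (hV.preimage_comp Sum.inl)
      (soloInformed_isSemialgebraic_setOf_and ?_ (soloInformed_isSemialgebraic_setOf_and ?_ ?_))
    · exact soloInformed_isSemialgebraic_setOf_forall fun t =>
        soloInformed_isSemialgebraic_setOf_forall fun t' =>
        soloInformed_isSemialgebraic_setOf_forall_prop fun h =>
        soloInformed_isSemialgebraic_setOf_imp (soloInformed_isSemialgebraic_setOf_const _)
          (SoloInformedPTerm.isSemialgebraic_setOf_coin _ _)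
    · exact soloInformed_isSemialgebraic_setOf_forall fun t =>
        soloInformed_isSemialgebraic_setOf_forall fun j =>
        soloInformed_isSemialgebraic_setOf_forall_prop fun h =>
        soloInformed_isSemialgebraic_setOf_imp (soloInformed_isSemialgebraic_setOf_const _)
          (SoloInformedPTerm.isSemialgebraic_setOf_coin _ _)
    · exact soloInformed_isSemialgebraic_setOf_forall fun j =>
        soloInformed_isSemialgebraic_setOf_forall fun j' =>
        soloInformed_isSemialgebraic_setOf_forall_prop fun h =>
        soloInformed_isSemialgebraic_setOf_imp (soloInformed_isSemialgebraic_setOf_const _)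
          (SoloInformedPTerm.isSemialgebraic_setOf_coin _ _)
  -- (2) the clauses hold at `(p₀, s₀)`
  have hadm₀ : P'.SoloInformedAdmI p₀' := hP'adm p₀' (by rw [hp₀']; exact hp₀)
  have hValid₀ : Valid p₀' := by
    refine ⟨by rw [hp₀']; exact hp₀, fun t t' h hk => ?_, fun t j h hk => ?_, fun j j' h hk => ?_⟩
    · obtain ⟨h', hk'⟩ := (SoloInformedPTerm.sigma_mk_eq_iff _ _).1 hk
      refine SoloInformedPTerm.coin_of_repI_eq
        ((SoloInformedPTerm.admI_castDim_iff h _ _).2 (hadm₀ t)) (hadm₀ t') ?_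
      rw [SoloInformedPTerm.repI_castDim]
      exact hk'
    · obtain ⟨h', hk'⟩ := (SoloInformedPTerm.sigma_mk_eq_iff _ _).1 hk
      refine SoloInformedPTerm.coin_scaledConst_of_repI_eq
        ((SoloInformedPTerm.admI_castDim_iff h _ _).2 (hadm₀ t)) ?_
      rw [SoloInformedPTerm.repI_castDim]
      exact hk'
    · obtain ⟨h', hk'⟩ := (SoloInformedPTerm.sigma_mk_eq_iff _ _).1 hk
      exact SoloInformedPTerm.coin_castDim_scaledConst_of_eq h hk'
  -- (3) the projection to the scalars is `ℚ`-semialgebraic and contains `s₀`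
  refine ⟨(fun p : K ⊕ Fin M → ℝ => p ∘ Sum.inr) '' {p | Valid p},
    hValid.image_comp_of_finite Sum.inr, ⟨p₀', hValid₀, Sum.elim_comp_inr p₀ s₀⟩, ?_⟩
  rintro s ⟨p', ⟨hp'V, hcl, hclC, hCC⟩, rfl⟩
  -- (4) at a parameter satisfying the clauses the scaled sum is a relation:
  --     class functions in `FormalRep ℝ ⧸ relations ℝ`
  have hadm' : P'.SoloInformedAdmI p' := hP'adm p' hp'V
  let N := KZOver.relations ℝ
  let π : KZOver.FormalRep ℝ →+ KZOver.FormalRep ℝ ⧸ N := QuotientAddGroup.mk' N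
  have hπ : ∀ x y : KZOver.FormalRep ℝ, x - y ∈ N → π x = π y := fun x y hxy => by
    simp only [π]
    rw [QuotientAddGroup.mk'_apply, QuotientAddGroup.mk'_apply, QuotientAddGroup.eq_iff_sub_mem]
    exact hxy
  have hsum := P'.sum_eq_sum_of_comboI_eq κ ε hcombo'
    (fun t => π (KZOver.of ((P'.term t).repI p'))) (fun j => π (KZOver.of ((C j).repI p')))
    (fun t t' hk => ?_) (fun t j hk => ?_) (fun j j' hk => ?_)
  · have hzero : ∑ t, P'.coef t • π (KZOver.of ((P'.term t).repI p')) = 0 := by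
      have h₁ : π (P'.comboI p') = ∑ t, P'.coef t • π (KZOver.of ((P'.term t).repI p')) := by
        unfold SoloInformedPCombo.comboI
        rw [map_sum]
        simp only [map_zsmul]
      rw [← h₁]
      simp only [π]
      rw [QuotientAddGroup.mk'_apply, QuotientAddGroup.eq_zero_iff]
      exact hP'rel p' hp'V
    have hrhs : π (soloInformedScaledSum R slot ε (p' ∘ Sum.inr)) =
        ∑ j, ε j • π (KZOver.of ((C j).repI p')) := by
      unfold soloInformedScaledSum
      rw [map_sum]
      simp only [map_zsmul]
      refine Finset.sum_congr rfl fun j _ => ?_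
      congr 1
      exact (hπ _ _ (SoloInformedPTerm.of_repI_scaledConst_sub_mem (Sum.inr (slot j)) (R j).2 p')).symm
    rw [hzero] at hsum
    have h₂ : π (soloInformedScaledSum R slot ε (p' ∘ Sum.inr)) = 0 := by rw [hrhs, ← hsum]
    simp only [π] at h₂
    rw [QuotientAddGroup.mk'_apply, QuotientAddGroup.eq_zero_iff] at h₂
    exact h₂
  · -- terms with equal keys at `(p₀, s₀)` denote congruent representations at `p'`
    have h : P'.dim t = P'.dim t' := (congrArg Sigma.fst hk :)
    exact hπ _ _ (SoloInformedPTerm.of_repI_sub_mem_of_coin_castDim h (hcl t t' h hk)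
      (hadm' t) (hadm' t'))
  · -- a term with a target key denotes the scaled target at `p'`, up to a relation
    have h : P'.dim t = (R j).1 := (congrArg Sigma.fst hk :)
    exact hπ _ _ (SoloInformedPTerm.of_repI_sub_mem_of_coin_castDim h (hclC t j h hk)
      (hadm' t) (hCadm j p'))
  · -- equal target keys: the two scaled constant terms denote congruent representations
    have h : (R j).1 = (R j').1 := (congrArg Sigma.fst hk :)
    exact hπ _ _ (SoloInformedPTerm.of_repI_sub_mem_of_coin_castDim h (hCC j j' h hk)
      (hCadm j p') (hCadm j' p'))

end Summit.KontsevichZagierPeriods.KontsevichZagierPeriods.Theorems
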